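import Summits.QuantumFields.YangMills.Theorems.UnitScaleTiltProp8FlatPortHRows12
import Summits.QuantumFields.YangMills.Theorems.UnitScaleTiltProp8FlatHCurlCurl
import Literature.MathematicalPhysics.QuantumFieldTheory.Balaban1983to89.B6Cor28KLevelV1
import Literature.MathematicalPhysics.QuantumFieldTheory.Balaban1983to89.B6LapLegKLevelV1
import HarnessLib

/-!
# Route `UnitScaleTilt`, crux K1 child «MinimiserStabilityRegPr» (stmt-QuantumFields-19200), v8 pillar **P2 `stub_flatOpsCubeSeq`** — THE PORT BRIDGE, file 7:
# **THE SECOND-ORDER KERNEL ROWS (k3) `∂*∂H`, (k4) `ΔH` OF `FlatOpsHRowsFromKernels.HKernelRows` FOR THE CANONICAL `flatH` AT A CHARTED FAMILY, FROM THE PORT's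
# SHAPES**: (k3) = [Balaban1985Variational] (137) `∂*∂H = Q*((QGQ*)⁻¹ − a)` (EXACT, g16's `FlatHCurlCurl.curlCurl_hOp`) + r03's composition step
# `B6Cor28KLevelV1.comp_entry_le` with the IDENTITY as left factor (the entries of `Q*(QGQ*)⁻¹` from the (2.149) entries) + the local `Q*a` term; (k4) = `comp_entry_le` with the
# left factor `Δ∘G` (lit-balaban's (2.136)₄ Laplacian majorant `LapV c′ ∘ onFun G`, shape of `B6Prop26LapKLevelV1.prop26_2136_lap_kLevel_unconditional(_pad_V1)`) — print's route
# p. 298–299 «(137) hence |Δ_πHB|_{(−3)} ≦ O(1)|B| … (130)»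

Cell `ym3-torus` (HUMAN RULING D-0037, YM ladder rung R3), seat `ym3-torus-p1` gen 17.  `--supports stmt-QuantumFields-19200 --as helper`; count-neutral; def-free.

WHAT IS PROVED (sorry-free; axioms standard; no definition).  At the carrier `F = ⟨ℓ+1, hL, m, hm⟩`, `k = K − n ≥ 1`, `D : TDomains 2 ℓ M_h (K−n) P′ R` charted by `hN`, units
`c′ = L^{K−n}`, band weights `w♯` (`GlobalBand b₀ b₁ c′ w♯`):
* §1 `hasMajorant_one` (the identity has the majorant `1·e^{−δd_T}`), `aE_single`, **`toLp_flatH_eq_hOp`** / **`curlCurl_flatH_band`** ((137) for `flatH` at the band weights: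
  `∂*∂(flatH X) = Q*((QGQ*)⁻¹_{w♯}X) − Q*(a_{w♯}X)`), `onFun_H_eq_flatH`, `levWeight_eq` (`w m b = (L^{j(b)}/c′)^m`), `pref_blkV1` (`pref(y(b)) = (L^{j(b)}/c′)²`);
* §2 **`hRow3_of_portShapes`**: from the (2.149) entries `h2149` (shape of `B6QGQCoerciveKLevelV1.prop27_kLevel_unconditional`, constants `Cγ`, rate `δ`), the absorption threshold
  `L^{d+3}e^{−(δ/2)(R·L·M_h−1)} ≤ 1` and (2.63) at rate `δ/2` (`Ineq263With c63`): for every P2 weight family, index bond `c`, indicator `e_c`, fine bond `b`,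
  `w₃(b)·|(∂^{η*}∂^η flatH e_c)(b)| ≤ (K₃·e^{3r} + b₁·e^{r(ℓ+6)})·e^{−r·(d_T(y(b), β c) + 3)}`, `r = (1−α′)(δ/2)`, `K₃` = r03's composition constant;
* §3 **`hRow4_of_portShapes`**: from the same plus the (2.136)₄ majorant `A·e^{−δ₃d_T}` of `LapV c′ ∘ onFun G` (`0 < δ ≤ δ₃`):
  `w₂(b)·(c′)²·|Σ_ν((He_c)(b) − (He_c)(b+e_ν)) + ((He_c)(b) − (He_c)(b−e_ν))| ≤ A·K₃·e^{3r}·e^{−r·(d_T + 3)}`.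
So rows (k3), (k4) of `HKernelRows … (d_T + 3) w (flatH …)` hold at every charted family once the port's (2.149) and (2.136)₄ are supplied (hypothesis-free: files 6, and lit-balaban's
`prop26_2136_lap_kLevel_unconditional_pad_V1`).  HONEST SCOPE: translation/bookkeeping; NOT a claim about the mass gap.

References: T. Bałaban, CMP **102** (1985) 277–309 [Balaban1985Variational] (130) p.298, (137)–(140) p.298–299, (161) p.303; CMP **96** (1984) 223–250 [Balaban1984PropagatorsII]
Prop. 2.6 (2.136) p.247, Prop. 2.7 (2.149) p.249, Cor. 2.8 (2.150)–(2.151) p.249, Lemma 2.1 (2.60)–(2.63) p.234.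
-/

set_option autoImplicit false

noncomputable section

open scoped BigOperators InnerProductSpace

namespace Summit.QuantumFields.YangMills.Theorems.FlatPortHRows34

/-- `1 ≤ 3` (the dimension hypothesis of the d = 3 carrier, named once so that every `domT`/`PV` below carries the same proof term). [folklore] -/
private theorem hd3 : 1 ≤ 2 + 1 := by norm_num

open Literature.MathematicalPhysics.QuantumFieldTheory.Balaban1983to89
open Literature.MathematicalPhysics.QuantumFieldTheory.BalabanImbrieJaffe1984to88.BIJ85AxialPropagator411 (BondSpace)
open B5Eq118OneStroke (iterBlockOf iterBlock mem_iterBlock)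
open LatticeFieldCalculus (runSite runBond)
open B6MultiLevelBoxOperator (N0)
open B6MultiLevelTorusOperator (TDomains)
open B6Geom246MultiLevelBox (bset blkOf)
open B6Geom246MultiLevelTorus (geomT bondT)
open B6GlobalChartV1 (PV toBox blkV1 domT)
open B6Ineq2142KLevelV1 (lvl lvl_le lvl_le_mK β qwt qwt_nonneg qwt_le QsE_single_apply exists_of_qwt_ne_zero iterBlockOf_runSite_mem lev_ends_bounds
  geomT_dist_ends_le)
open B6Ineq2133TwoScaleV1 (onFun onFun_apply)
open B6GradLegKLevelV1 (DV)
open B6LapLegKLevelV1 (LapV LapV_apply)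
open B6RandomWalk (HasMajorant BlockSupp)
open B6Lemma21Repaired (Ineq263With)
open B6Prop26KLevelSkeletonV1 (pref)
open B6Prop27KLevelV1 (lam)
open B6Cor28KLevelV1 (comp_entry_le onFun_comp)
open B6SectADomainsV1 (Domains)
open B6SectAOperatorsV1 (BondIdx BondIdxSpace QsE aE dcE dcsE aE_apply)
open B6SectAVectorModelV1 (GE EE)
open B6SectA (hOp)
open B6CubeWindowV1 (GlobalBand)
open B11Eq115Space (levOf)
open T3ContinuumYM3Torus (T3Family)
open FlatCubeOpsText (IsLevWeight)
open FlatOpsLettersAssembly (flatH)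
open FlatPortDistance (levOf_domT blkV1_level)
open FlatPortHRows12 (cf_ne_zero flatH_apply_eq toLp_indicator_eq_single indicator_eq_single)

/-! ## §1 Identities -/

section Generic

variable {d ℓ Mh k R : ℕ} {P' : Fin (d + 1) → ℕ} {m K : ℕ} {hd : 1 ≤ d + 1} {hL : Odd (ℓ + 1) ∧ 1 < ℓ + 1}

/-- the identity operator has the majorant `1·e^{−δd_T}` (`d_T(y, y) = 0`). [cite: Balaban1984PropagatorsII, (2.51) p.232, bookkeeping] -/
theorem hasMajorant_one (hN : ∀ μ, N0 ℓ Mh k P' μ = (PV d ℓ m K hd hL).sitesPerDir 0) (D : TDomains d ℓ Mh k P' R) (δ₃ : ℝ) :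
    HasMajorant (g := geomT D) (blkV1 hN D) (1 : Module.End ℝ (PBond (PV d ℓ m K hd hL) 0 → ℝ))
      (fun y y' => (1 : ℝ) * Real.exp (-(δ₃ * (geomT D).dist y y'))) := by
  intro y' μ B hB x
  rw [Module.End.one_apply]
  show |μ x| ≤ 1 * Real.exp (-(δ₃ * (geomT D).dist (blkV1 hN D x) y')) * B
  by_cases hx : blkV1 hN D x = y'
  · rw [hx]
    have h0 : (geomT D).dist y' y' = 0 := by
      change (((bondT D).dist y' y' : ℕ) : ℝ) = 0
      rw [SimpleGraph.dist_self]; simp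
    rw [h0, mul_zero, neg_zero, Real.exp_zero, one_mul, one_mul]
    exact hB.bound x hx
  · rw [hB.off x hx, abs_zero]
    have := hB.nonneg
    positivity

/-- `a·e_c = a(c)·e_c` for the weight operator `aE`. [cite: Balaban1984PropagatorsII, (2.18) p.226, bookkeeping] -/
theorem aE_single {P : Params} (Dm : Domains P) (w : BondIdx Dm → ℝ) (c : BondIdx Dm) :
    aE Dm w (EuclideanSpace.single c (1 : ℝ)) = w c • EuclideanSpace.single c (1 : ℝ) := by
  classical
  have h1 : (fun i => w i * (Pi.single c (1 : ℝ) : BondIdx Dm → ℝ) i) = w c • (Pi.single c (1 : ℝ) : BondIdx Dm → ℝ) := by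
    funext i
    rw [Pi.smul_apply, smul_eq_mul]
    by_cases hi : i = c
    · subst hi; rfl
    · rw [Pi.single_eq_of_ne hi, mul_zero, mul_zero]
  show WithLp.toLp 2 (fun i => w i * (Pi.single c (1 : ℝ) : BondIdx Dm → ℝ) i) = w c • WithLp.toLp 2 (Pi.single c (1 : ℝ))
  rw [h1, WithLp.toLp_smul]

end Generic

section Carrier

variable (ℓ : ℕ) (hL : Odd (ℓ + 1) ∧ 1 < ℓ + 1) (m : ℕ) (hm : 1 ≤ m) (n K : ℕ)
variable {Mh R : ℕ} {P' : Fin (2 + 1) → ℕ}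
variable (hN : ∀ μ, N0 ℓ Mh (K - n) P' μ = (PV 2 ℓ m K hd3 hL).sitesPerDir 0) (D : TDomains 2 ℓ Mh (K - n) P' R) (hk : K - n ≤ m + K)

/-- **`flatH` AS AN `ℓ²` VECTOR IS `hOp` AT ANY POSITIVE WEIGHTS** (canonicity). [cite: Balaban1984PropagatorsII, (2.35) p.228; Balaban1985Variational, (157) p.302] -/
theorem toLp_flatH_eq_hOp {ws : BondIdx (domT (hd := hd3) hN D hk) → ℝ} (hws : ∀ i, 0 < ws i) (X : BondIdx (domT (hd := hd3) hN D hk) → ℝ) :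
    WithLp.toLp 2 (flatH (⟨ℓ + 1, hL, m, hm⟩ : T3Family) n K (domT (hd := hd3) hN D hk) X) =
      hOp (GE (domT (hd := hd3) hN D hk) (cf_ne_zero ℓ n K) hws) (QsE (domT (hd := hd3) hN D hk))
        (EE (domT (hd := hd3) hN D hk) (cf_ne_zero ℓ n K) hws) (WithLp.toLp 2 X) := by
  have h0 : WithLp.toLp 2 (flatH (⟨ℓ + 1, hL, m, hm⟩ : T3Family) n K (domT (hd := hd3) hN D hk) X) =
      hOp (GE (domT (hd := hd3) hN D hk) (cf_ne_zero ℓ n K) (fun _ => one_pos) (w := fun _ => (1 : ℝ)))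
        (QsE (domT (hd := hd3) hN D hk)) (EE (domT (hd := hd3) hN D hk) (cf_ne_zero ℓ n K) (fun _ => one_pos) (w := fun _ => (1 : ℝ)))
        (WithLp.toLp 2 X) := rfl
  rw [h0, FlatCubeOperators.hOp_eq_hOp (domT (hd := hd3) hN D hk) (cf_ne_zero ℓ n K) (fun _ => one_pos) hws (WithLp.toLp 2 X)]

/-- **(137) FOR `flatH` AT THE BAND WEIGHTS**: `∂*∂(flatH X) = Q*((QGQ*)⁻¹_{w♯}X) − Q*(a_{w♯}X)` (exact). [cite: Balaban1985Variational, (137) p.298] -/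
theorem curlCurl_flatH_band {ws : BondIdx (domT (hd := hd3) hN D hk) → ℝ} (hws : ∀ i, 0 < ws i) (X : BondIdx (domT (hd := hd3) hN D hk) → ℝ) :
    dcsE ((((ℓ + 1 : ℕ) : ℝ)) ^ (K - n)) (dcE ((((ℓ + 1 : ℕ) : ℝ)) ^ (K - n)) (WithLp.toLp 2 (flatH (⟨ℓ + 1, hL, m, hm⟩ : T3Family) n K (domT (hd := hd3) hN D hk) X))) =
      QsE (domT (hd := hd3) hN D hk) (EE (domT (hd := hd3) hN D hk) (cf_ne_zero ℓ n K) hws (WithLp.toLp 2 X)) -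
        QsE (domT (hd := hd3) hN D hk) (aE (domT (hd := hd3) hN D hk) ws (WithLp.toLp 2 X)) := by
  rw [toLp_flatH_eq_hOp ℓ hL m hm n K hN D hk hws X]
  exact FlatHCurlCurl.curlCurl_hOp (domT (hd := hd3) hN D hk) (cf_ne_zero ℓ n K) hws (WithLp.toLp 2 X)

/-- the bond-function reading of the port's `H` against `Pi.single c 1` is `flatH e_c`. [cite: Balaban1984PropagatorsII, (2.150) p.249] -/
theorem onFun_H_eq_flatH {ws : BondIdx (domT (hd := hd3) hN D hk) → ℝ} (hws : ∀ i, 0 < ws i)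
    {c : BondIdx (domT (hd := hd3) hN D hk)} {e : BondIdx (domT (hd := hd3) hN D hk) → ℝ} (he : e c = 1) (he' : ∀ c', c' ≠ c → e c' = 0) :
    onFun (GE (domT (hd := hd3) hN D hk) (cf_ne_zero ℓ n K) hws ∘ₗ QsE (domT (hd := hd3) hN D hk) ∘ₗ
        EE (domT (hd := hd3) hN D hk) (cf_ne_zero ℓ n K) hws) (Pi.single c 1) =
      flatH (⟨ℓ + 1, hL, m, hm⟩ : T3Family) n K (domT (hd := hd3) hN D hk) e := by
  funext b
  rw [onFun_apply, ← indicator_eq_single he he', flatH_apply_eq ℓ hL m hm n K hN D hk hws he he' b, toLp_indicator_eq_single he he']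

/-- **THE LEVEL WEIGHTS**: `w m b = (L^{j(b)}/c′)^m`, `j(b) = D.lev (toBox b₋)`, `c′ = L^{K−n}`. [cite: Balaban1985Variational, p.286, (115) p.294] -/
theorem levWeight_eq {w : ℕ → PBond (PV 2 ℓ m K hd3 hL) 0 → ℝ}
    (hw : IsLevWeight (⟨ℓ + 1, hL, m, hm⟩ : T3Family) n K (domT (hd := hd3) hN D hk) w) (mm : ℕ) (b : PBond (PV 2 ℓ m K hd3 hL) 0) :
    w mm b = ((((ℓ + 1 : ℕ) : ℝ)) ^ D.lev (toBox hN b.src : Fin (2 + 1) → ℤ) / (((ℓ + 1 : ℕ) : ℝ)) ^ (K - n)) ^ mm := by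
  rw [hw mm b]
  have hlev := levOf_domT (hd := hd3) hN D hk b.src
  show (((((⟨ℓ + 1, hL, m, hm⟩ : T3Family).L : ℕ) : ℝ)) ^ levOf (fun j => {x : Site (PV 2 ℓ m K hd3 hL) 0 | (domT (hd := hd3) hN D hk).InOm j x}) (K - n) b.src *
      (((((⟨ℓ + 1, hL, m, hm⟩ : T3Family).L : ℕ) : ℝ))⁻¹) ^ (K - n)) ^ mm = _
  rw [hlev, inv_pow, div_eq_mul_inv]

/-- `pref(y(b)) = (L^{j(b)}/c′)²`. [cite: Balaban1984PropagatorsII, (2.136) p.247, bookkeeping] -/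
theorem pref_blkV1 (cf : ℝ) (b : PBond (PV 2 ℓ m K hd3 hL) 0) :
    pref cf (blkV1 hN D b) = ((((ℓ + 1 : ℕ) : ℝ)) ^ D.lev (toBox hN b.src : Fin (2 + 1) → ℤ) / cf) ^ 2 := rfl

/-! ## §2 Row (k3): `∂*∂H` -/

/-- **ROW (k3) OF `HKernelRows` FROM THE PORT's SHAPES**: (137) + `comp_entry_le` (left factor `1`) + the local `Q*a` term.  Hypotheses: `k ≥ 1`, `R·M_h ≥ 2`, `M_h ≥ 1`, `P′ ≥ 1`; band
weights `w♯` with `GlobalBand b₀ b₁ c′ w♯` (`0 ≤ b₁`); the (2.149) entries `h2149` (constant `Cγ ≥ 0`, rate `δ > 0`, any `δ₃ ≥ δ`); the absorption threshold and (2.63) at rate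
`δ/2`.  Conclusion, with `r := (1−α′)(δ/2)` and r03's composition constant `K₃`:
`w₃(b)·|(∂^{η*}∂^η flatH e_c)(b)| ≤ (K₃·e^{3r} + b₁·e^{r(ℓ+6)})·e^{−r(d_T(y(b), β c) + 3)}`.
[cite: Balaban1985Variational, (137)-(140) p.298-299, (161) p.303; Balaban1984PropagatorsII, Prop. 2.7 (2.149), Cor. 2.8 (2.151) p.249] -/
theorem hRow3_of_portShapes (hk1 : 1 ≤ K - n) (hRM : 2 ≤ R * Mh) (hMh : 1 ≤ Mh) (hP : ∀ μ, 1 ≤ P' μ)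
    {ws : BondIdx (domT (hd := hd3) hN D hk) → ℝ} (hws : ∀ i, 0 < ws i) {b₀ b₁ : ℝ} (hb₁ : 0 ≤ b₁) (hband : GlobalBand b₀ b₁ ((((ℓ + 1 : ℕ) : ℝ)) ^ (K - n)) ws)
    {δ₃ Cγ δ c63 α' : ℝ} (hCγ : 0 ≤ Cγ) (hδ : 0 < δ) (hδ3 : δ ≤ δ₃) (hα' : α' ≤ 1)
    (h2149 : ∀ c' c : BondIdx (domT (hd := hd3) hN D hk),
      |⟪EuclideanSpace.single c' (1 : ℝ), EE (domT (hd := hd3) hN D hk) (cf_ne_zero ℓ n K) hws (EuclideanSpace.single c (1 : ℝ))⟫_ℝ| ≤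
        (lam hN D hk ((((ℓ + 1 : ℕ) : ℝ)) ^ (K - n)) c')⁻¹ * (lam hN D hk ((((ℓ + 1 : ℕ) : ℝ)) ^ (K - n)) c)⁻¹ *
          (Cγ * Real.exp (-(δ * (geomT D).dist (β hN D hk c') (β hN D hk c)))))
    (hsmall : ((ℓ : ℝ) + 1) ^ (2 + 3) * Real.exp (-(δ / 2 * ((R : ℝ) * (((ℓ : ℝ) + 1) * Mh) - 1))) ≤ 1)
    (h263 : Ineq263With c63 (geomT D) (δ / 2) α')
    (w : ℕ → PBond (PV 2 ℓ m K hd3 hL) 0 → ℝ) (hw : IsLevWeight (⟨ℓ + 1, hL, m, hm⟩ : T3Family) n K (domT (hd := hd3) hN D hk) w)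
    (c : BondIdx (domT (hd := hd3) hN D hk)) (e : BondIdx (domT (hd := hd3) hN D hk) → ℝ) (he : e c = 1) (he' : ∀ c', c' ≠ c → e c' = 0)
    (b : PBond (PV 2 ℓ m K hd3 hL) 0) :
    w 3 b * |(dcsE ((((ℓ + 1 : ℕ) : ℝ)) ^ (K - n)) (dcE ((((ℓ + 1 : ℕ) : ℝ)) ^ (K - n))
        (WithLp.toLp 2 (flatH (⟨ℓ + 1, hL, m, hm⟩ : T3Family) n K (domT (hd := hd3) hN D hk) e)))) b| ≤
      ((Cγ * (2 * (((ℓ + 1 : ℕ) : ℝ)) ^ (2 + 1) * Real.exp (δ₃ * ((ℓ : ℝ) + 3))) * ((ℓ : ℝ) + 1) ^ 2 * ((ℓ : ℝ) + 1) ^ (2 + 3) * (2 * ((2 : ℝ) + 1)) * c63 ^ 2) *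
          Real.exp (3 * ((1 - α') * (δ / 2))) + b₁ * Real.exp ((1 - α') * (δ / 2) * ((ℓ : ℝ) + 6))) *
        Real.exp (-((1 - α') * (δ / 2) * (((bondT D).dist (blkV1 hN D b) (β hN D hk c) : ℝ) + 3))) := by
  -- notation
  set cf : ℝ := (((ℓ + 1 : ℕ) : ℝ)) ^ (K - n) with hcf
  set r : ℝ := (1 - α') * (δ / 2) with hr
  set K₃ : ℝ := Cγ * (2 * (((ℓ + 1 : ℕ) : ℝ)) ^ (2 + 1) * Real.exp (δ₃ * ((ℓ : ℝ) + 3))) * ((ℓ : ℝ) + 1) ^ 2 * ((ℓ : ℝ) + 1) ^ (2 + 3) * (2 * ((2 : ℝ) + 1)) * c63 ^ 2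
    with hK₃
  set dT : ℝ := ((bondT D).dist (blkV1 hN D b) (β hN D hk c) : ℝ) with hdT
  have hdist : (geomT D).dist (blkV1 hN D b) (β hN D hk c) = dT := rfl
  have hL0 : (0 : ℝ) < ((ℓ + 1 : ℕ) : ℝ) := by exact_mod_cast Nat.succ_pos ℓ
  have hL1 : (1 : ℝ) ≤ ((ℓ + 1 : ℕ) : ℝ) := by exact_mod_cast Nat.succ_le_succ (Nat.zero_le ℓ)
  have hcf0 : 0 < cf := pow_pos hL0 _
  have hr0 : 0 ≤ r := by rw [hr]; exact mul_nonneg (by linarith) (by linarith)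
  have hK₃0 : 0 ≤ K₃ := by rw [hK₃]; positivity
  have hdT0 : 0 ≤ dT := Nat.cast_nonneg _
  set Lj : ℝ := (((ℓ + 1 : ℕ) : ℝ)) ^ D.lev (toBox hN b.src : Fin (2 + 1) → ℤ) with hLj
  have hLj0 : 0 < Lj := pow_pos hL0 _
  have hLjcf : Lj ≤ cf := pow_le_pow_right₀ hL1 (D.lev_le _)
  -- (137) at the band weights, read at `b`
  have hcc := curlCurl_flatH_band ℓ hL m hm n K hN D hk hws e
  rw [toLp_indicator_eq_single he he'] at hcc
  rw [hcc, PiLp.sub_apply]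
  -- term A: `Q*(QGQ*)⁻¹e_c` through the composition step with the identity as left factor
  have hA : |QsE (domT (hd := hd3) hN D hk) (EE (domT (hd := hd3) hN D hk) (cf_ne_zero ℓ n K) hws (EuclideanSpace.single c (1 : ℝ))) b| ≤
      (1 : ℝ) / pref cf (blkV1 hN D b) * K₃ * Real.exp (-(r * dT)) := by
    have h := comp_entry_le hN D hk (cf_ne_zero ℓ n K) hws hk1 hRM hMh hP (T := (1 : Module.End ℝ (PBond (PV 2 ℓ m K hd3 hL) 0 → ℝ)))
      (F := fun _ => (1 : ℝ)) (fun _ => zero_le_one) hCγ hδ hδ3 (hasMajorant_one hN D δ₃) h2149 hsmall h263 c b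
    rw [LinearMap.comp_apply, Module.End.one_apply, onFun_apply, LinearMap.comp_apply] at h
    rw [hdist] at h
    exact h
  -- term B: the local `Q*a e_c = a(c)·q_c`
  have hBeq : QsE (domT (hd := hd3) hN D hk) (aE (domT (hd := hd3) hN D hk) ws (EuclideanSpace.single c (1 : ℝ))) b = ws c * qwt hN D hk c b := by
    rw [aE_single, map_smul, PiLp.smul_apply, smul_eq_mul, QsE_single_apply]
  -- the weights
  have hw3 : w 3 b = (Lj / cf) ^ 3 := levWeight_eq ℓ hL m hm n K hN D hk hw 3 b
  have hpref : pref cf (blkV1 hN D b) = (Lj / cf) ^ 2 := pref_blkV1 ℓ hL m n K hN D cf b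
  have hq0 : 0 ≤ Lj / cf := div_nonneg hLj0.le hcf0.le
  have hq1 : Lj / cf ≤ 1 := (div_le_one hcf0).2 hLjcf
  -- bound on term A with the weight: `(Lj/cf)³/(Lj/cf)² = Lj/cf ≤ 1`
  have hA' : w 3 b * |QsE (domT (hd := hd3) hN D hk) (EE (domT (hd := hd3) hN D hk) (cf_ne_zero ℓ n K) hws (EuclideanSpace.single c (1 : ℝ))) b| ≤
      K₃ * Real.exp (-(r * dT)) := by
    rw [hw3]
    refine (mul_le_mul_of_nonneg_left hA (pow_nonneg hq0 3)).trans ?_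
    rw [hpref]
    have hq0' : 0 < Lj / cf := div_pos hLj0 hcf0
    have e1 : (Lj / cf) ^ 3 * (1 / (Lj / cf) ^ 2 * K₃ * Real.exp (-(r * dT))) = (Lj / cf) * (K₃ * Real.exp (-(r * dT))) := by
      have hq : (Lj / cf) ^ 2 ≠ 0 := pow_ne_zero _ hq0'.ne'
      calc (Lj / cf) ^ 3 * (1 / (Lj / cf) ^ 2 * K₃ * Real.exp (-(r * dT)))
          = (Lj / cf) * ((Lj / cf) ^ 2 * (1 / (Lj / cf) ^ 2)) * (K₃ * Real.exp (-(r * dT))) := by ring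
        _ = (Lj / cf) * (K₃ * Real.exp (-(r * dT))) := by rw [mul_one_div_cancel hq, mul_one]
    rw [e1]
    exact (mul_le_of_le_one_left (by positivity) hq1)
  -- bound on term B with the weight
  have hB' : w 3 b * |ws c * qwt hN D hk c b| ≤ b₁ * Real.exp (r * ((ℓ : ℝ) + 6)) * Real.exp (-(r * (dT + 3))) := by
    by_cases hq : qwt hN D hk c b = 0
    · rw [hq, mul_zero, abs_zero, mul_zero]; positivity
    · -- support: `b` issues from the double block of `c`
      obtain ⟨x', hx', t', ht', hfb⟩ := exists_of_qwt_ne_zero hN D hk c hq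
      rw [mem_iterBlock] at hx'
      have hsrc : b.src = runSite x' c.1.2.dir t' := by rw [← hfb]; rfl
      have hends : iterBlockOf (lvl hN D hk c) b.src = c.1.2.src ∨ iterBlockOf (lvl hN D hk c) b.src = c.1.2.tgt := by
        rw [hsrc]
        rcases iterBlockOf_runSite_mem (lvl_le_mK hN D hk c) x' c.1.2.dir ht'.le with h | h
        · exact Or.inl (h.trans hx')
        · right; rw [h, hx']; rfl
      have hlev := (lev_ends_bounds hN D hk hk1 hRM c hends).2
      have hnear : (geomT D).dist (β hN D hk c) (blkOf D.toDomains (toBox hN b.src)) ≤ (ℓ : ℝ) + 3 := geomT_dist_ends_le hN D hk hk1 hRM hMh hP c hends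
      have hdTle : dT ≤ (ℓ : ℝ) + 3 := by
        have hsymm : (geomT D).dist (β hN D hk c) (blkOf D.toDomains (toBox hN b.src)) = dT := by
          rw [hdT]; change (((bondT D).dist _ _ : ℕ) : ℝ) = (((bondT D).dist _ _ : ℕ) : ℝ); rw [SimpleGraph.dist_comm]; rfl
        rw [hsymm] at hnear; exact hnear
      -- sizes: `w♯(c) ≤ b₁(c′/L^j)²(L^j)^{D}`, `q_c ≤ L^{−jD}`, `w₃(b) ≤ (L^j/c′)³`
      set j : ℕ := lvl hN D hk c with hj
      set Ljc : ℝ := (((ℓ + 1 : ℕ) : ℝ)) ^ j with hLjc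
      have hLjc0 : 0 < Ljc := pow_pos hL0 _
      have hLjLjc : Lj ≤ Ljc := pow_le_pow_right₀ hL1 hlev
      have hLjccf : Ljc ≤ cf := pow_le_pow_right₀ hL1 (lvl_le hN D hk c)
      have hwc : ws c ≤ b₁ * (Ljc ^ (2 + 1)) * (cf / Ljc) ^ 2 := by
        have h2 := (hband c).2
        have hpos : 0 < (cf / Ljc) ^ 2 := by positivity
        rw [div_le_iff₀ hpos] at h2
        exact h2
      have hqle : qwt hN D hk c b ≤ ((((ℓ + 1 : ℕ) : ℝ) ^ (2 + 1)) ^ j)⁻¹ := qwt_le hN D hk c b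
      have hvol : Ljc ^ (2 + 1) * ((((ℓ + 1 : ℕ) : ℝ) ^ (2 + 1)) ^ j)⁻¹ = 1 := by
        rw [hLjc, ← pow_mul, ← pow_mul, mul_comm j (2 + 1), mul_inv_cancel₀ (pow_ne_zero _ hL0.ne')]
      have hwq : ws c * qwt hN D hk c b ≤ b₁ * (cf / Ljc) ^ 2 := by
        calc ws c * qwt hN D hk c b ≤ (b₁ * (Ljc ^ (2 + 1)) * (cf / Ljc) ^ 2) * ((((ℓ + 1 : ℕ) : ℝ) ^ (2 + 1)) ^ j)⁻¹ :=
              mul_le_mul hwc hqle (qwt_nonneg hN D hk c b) (by positivity)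
          _ = b₁ * (cf / Ljc) ^ 2 * (Ljc ^ (2 + 1) * ((((ℓ + 1 : ℕ) : ℝ) ^ (2 + 1)) ^ j)⁻¹) := by ring
          _ = b₁ * (cf / Ljc) ^ 2 := by rw [hvol, mul_one]
      have hwq0 : 0 ≤ ws c * qwt hN D hk c b := mul_nonneg (hws c).le (qwt_nonneg hN D hk c b)
      rw [abs_of_nonneg hwq0, hw3]
      have hw3le : (Lj / cf) ^ 3 ≤ (Ljc / cf) ^ 3 := pow_le_pow_left₀ hq0 (div_le_div_of_nonneg_right hLjLjc hcf0.le) 3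
      have hmain : (Lj / cf) ^ 3 * (ws c * qwt hN D hk c b) ≤ b₁ := by
        have hx : (Ljc / cf) ^ 3 * (cf / Ljc) ^ 2 = Ljc / cf := by
          have h1 : Ljc ≠ 0 := hLjc0.ne'
          have h2 : cf ≠ 0 := hcf0.ne'
          field_simp
        calc (Lj / cf) ^ 3 * (ws c * qwt hN D hk c b) ≤ (Ljc / cf) ^ 3 * (b₁ * (cf / Ljc) ^ 2) := mul_le_mul hw3le hwq hwq0 (by positivity)
          _ = b₁ * ((Ljc / cf) ^ 3 * (cf / Ljc) ^ 2) := by ring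
          _ = b₁ * (Ljc / cf) := by rw [hx]
          _ ≤ b₁ * 1 := mul_le_mul_of_nonneg_left ((div_le_one hcf0).2 hLjccf) hb₁
          _ = b₁ := mul_one _
      have hexp : (1 : ℝ) ≤ Real.exp (r * ((ℓ : ℝ) + 6)) * Real.exp (-(r * (dT + 3))) := by
        rw [← Real.exp_add]
        apply Real.one_le_exp
        have e : r * ((ℓ : ℝ) + 6) + -(r * (dT + 3)) = r * (((ℓ : ℝ) + 3) - dT) := by ring
        rw [e]
        exact mul_nonneg hr0 (by linarith)
      calc (Lj / cf) ^ 3 * (ws c * qwt hN D hk c b) ≤ b₁ * 1 := by rw [mul_one]; exact hmain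
        _ ≤ b₁ * (Real.exp (r * ((ℓ : ℝ) + 6)) * Real.exp (-(r * (dT + 3)))) := mul_le_mul_of_nonneg_left hexp hb₁
        _ = _ := by ring
  -- assemble
  have hexpA : Real.exp (-(r * dT)) = Real.exp (3 * r) * Real.exp (-(r * (dT + 3))) := by rw [← Real.exp_add]; congr 1; ring
  rw [hexpA] at hA'
  have hw30 : 0 ≤ w 3 b := by rw [hw3]; positivity
  calc w 3 b * |QsE (domT (hd := hd3) hN D hk) (EE (domT (hd := hd3) hN D hk) (cf_ne_zero ℓ n K) hws (EuclideanSpace.single c (1 : ℝ))) b -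
        QsE (domT (hd := hd3) hN D hk) (aE (domT (hd := hd3) hN D hk) ws (EuclideanSpace.single c (1 : ℝ))) b|
      ≤ w 3 b * (|QsE (domT (hd := hd3) hN D hk) (EE (domT (hd := hd3) hN D hk) (cf_ne_zero ℓ n K) hws (EuclideanSpace.single c (1 : ℝ))) b| +
          |QsE (domT (hd := hd3) hN D hk) (aE (domT (hd := hd3) hN D hk) ws (EuclideanSpace.single c (1 : ℝ))) b|) :=
        mul_le_mul_of_nonneg_left (abs_sub _ _) hw30
    _ = w 3 b * |QsE (domT (hd := hd3) hN D hk) (EE (domT (hd := hd3) hN D hk) (cf_ne_zero ℓ n K) hws (EuclideanSpace.single c (1 : ℝ))) b| +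
          w 3 b * |ws c * qwt hN D hk c b| := by rw [mul_add, hBeq]
    _ ≤ K₃ * (Real.exp (3 * r) * Real.exp (-(r * (dT + 3)))) + b₁ * Real.exp (r * ((ℓ : ℝ) + 6)) * Real.exp (-(r * (dT + 3))) := add_le_add hA' hB'
    _ = (K₃ * Real.exp (3 * r) + b₁ * Real.exp (r * ((ℓ : ℝ) + 6))) * Real.exp (-(r * (dT + 3))) := by ring

/-! ## §3 Row (k4): `ΔH` -/

/-- **ROW (k4) OF `HKernelRows` FROM THE PORT's SHAPES**: `comp_entry_le` with the left factor `Δ∘G` (the (2.136)₄ majorant `A·e^{−δ₃d_T}` of `LapV c′ ∘ onFun G`).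
Conclusion: `w₂(b)·(c′)²·|Σ_ν((He_c)(b) − (He_c)(b+e_ν)) + ((He_c)(b) − (He_c)(b−e_ν))| ≤ A·K₃·e^{3r}·e^{−r(d_T(y(b), β c) + 3)}`, `r = (1−α′)(δ/2)`.
[cite: Balaban1985Variational, (130) p.298, (137)-(140) p.298-299; Balaban1984PropagatorsII, Prop. 2.6 (2.136) p.247, Prop. 2.7 (2.149), Cor. 2.8 (2.151) p.249] -/
theorem hRow4_of_portShapes (hk1 : 1 ≤ K - n) (hRM : 2 ≤ R * Mh) (hMh : 1 ≤ Mh) (hP : ∀ μ, 1 ≤ P' μ)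
    {ws : BondIdx (domT (hd := hd3) hN D hk) → ℝ} (hws : ∀ i, 0 < ws i)
    {A δ₃ Cγ δ c63 α' : ℝ} (hA : 0 ≤ A) (hCγ : 0 ≤ Cγ) (hδ : 0 < δ) (hδ3 : δ ≤ δ₃)
    (hLap : HasMajorant (g := geomT D) (blkV1 hN D)
      (LapV ((((ℓ + 1 : ℕ) : ℝ)) ^ (K - n)) ∘ₗ onFun (GE (domT (hd := hd3) hN D hk) (cf_ne_zero ℓ n K) hws))
      (fun y y' => A * Real.exp (-(δ₃ * (geomT D).dist y y'))))
    (h2149 : ∀ c' c : BondIdx (domT (hd := hd3) hN D hk),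
      |⟪EuclideanSpace.single c' (1 : ℝ), EE (domT (hd := hd3) hN D hk) (cf_ne_zero ℓ n K) hws (EuclideanSpace.single c (1 : ℝ))⟫_ℝ| ≤
        (lam hN D hk ((((ℓ + 1 : ℕ) : ℝ)) ^ (K - n)) c')⁻¹ * (lam hN D hk ((((ℓ + 1 : ℕ) : ℝ)) ^ (K - n)) c)⁻¹ *
          (Cγ * Real.exp (-(δ * (geomT D).dist (β hN D hk c') (β hN D hk c)))))
    (hsmall : ((ℓ : ℝ) + 1) ^ (2 + 3) * Real.exp (-(δ / 2 * ((R : ℝ) * (((ℓ : ℝ) + 1) * Mh) - 1))) ≤ 1)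
    (h263 : Ineq263With c63 (geomT D) (δ / 2) α')
    (w : ℕ → PBond (PV 2 ℓ m K hd3 hL) 0 → ℝ) (hw : IsLevWeight (⟨ℓ + 1, hL, m, hm⟩ : T3Family) n K (domT (hd := hd3) hN D hk) w)
    (c : BondIdx (domT (hd := hd3) hN D hk)) (e : BondIdx (domT (hd := hd3) hN D hk) → ℝ) (he : e c = 1) (he' : ∀ c', c' ≠ c → e c' = 0)
    (b : PBond (PV 2 ℓ m K hd3 hL) 0) :
    w 2 b * (((((ℓ + 1 : ℕ) : ℝ)) ^ (K - n)) ^ 2) *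
        |∑ ν : Fin (2 + 1), ((flatH (⟨ℓ + 1, hL, m, hm⟩ : T3Family) n K (domT (hd := hd3) hN D hk) e b -
              flatH (⟨ℓ + 1, hL, m, hm⟩ : T3Family) n K (domT (hd := hd3) hN D hk) e ⟨b.src.shift ν, b.dir⟩) +
            (flatH (⟨ℓ + 1, hL, m, hm⟩ : T3Family) n K (domT (hd := hd3) hN D hk) e b -
              flatH (⟨ℓ + 1, hL, m, hm⟩ : T3Family) n K (domT (hd := hd3) hN D hk) e ⟨b.src.unshift ν, b.dir⟩))| ≤
      A * ((Cγ * (2 * (((ℓ + 1 : ℕ) : ℝ)) ^ (2 + 1) * Real.exp (δ₃ * ((ℓ : ℝ) + 3))) * ((ℓ : ℝ) + 1) ^ 2 * ((ℓ : ℝ) + 1) ^ (2 + 3) * (2 * ((2 : ℝ) + 1)) * c63 ^ 2) *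
          Real.exp (3 * ((1 - α') * (δ / 2)))) *
        Real.exp (-((1 - α') * (δ / 2) * (((bondT D).dist (blkV1 hN D b) (β hN D hk c) : ℝ) + 3))) := by
  set cf : ℝ := (((ℓ + 1 : ℕ) : ℝ)) ^ (K - n) with hcf
  set r : ℝ := (1 - α') * (δ / 2) with hr
  set K₃ : ℝ := Cγ * (2 * (((ℓ + 1 : ℕ) : ℝ)) ^ (2 + 1) * Real.exp (δ₃ * ((ℓ : ℝ) + 3))) * ((ℓ : ℝ) + 1) ^ 2 * ((ℓ : ℝ) + 1) ^ (2 + 3) * (2 * ((2 : ℝ) + 1)) * c63 ^ 2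
    with hK₃
  set dT : ℝ := ((bondT D).dist (blkV1 hN D b) (β hN D hk c) : ℝ) with hdT
  have hdist : (geomT D).dist (blkV1 hN D b) (β hN D hk c) = dT := rfl
  have hL0 : (0 : ℝ) < ((ℓ + 1 : ℕ) : ℝ) := by exact_mod_cast Nat.succ_pos ℓ
  have hcf0 : 0 < cf := pow_pos hL0 _
  set Lj : ℝ := (((ℓ + 1 : ℕ) : ℝ)) ^ D.lev (toBox hN b.src : Fin (2 + 1) → ℤ) with hLj
  have hLj0 : 0 < Lj := pow_pos hL0 _
  -- the composition step with `T = Δ∘G`, `F ≡ A`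
  have h := comp_entry_le hN D hk (cf_ne_zero ℓ n K) hws hk1 hRM hMh hP
    (T := LapV ((((ℓ + 1 : ℕ) : ℝ)) ^ (K - n)) ∘ₗ onFun (GE (domT (hd := hd3) hN D hk) (cf_ne_zero ℓ n K) hws))
    (F := fun _ => A) (fun _ => hA) hCγ hδ hδ3 hLap h2149 hsmall h263 c b
  -- its left side is `Δ(flatH e_c)(b)`
  have hcomp : (LapV ((((ℓ + 1 : ℕ) : ℝ)) ^ (K - n)) ∘ₗ onFun (GE (domT (hd := hd3) hN D hk) (cf_ne_zero ℓ n K) hws)) ∘ₗ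
        onFun (QsE (domT (hd := hd3) hN D hk) ∘ₗ EE (domT (hd := hd3) hN D hk) (cf_ne_zero ℓ n K) hws) =
      LapV ((((ℓ + 1 : ℕ) : ℝ)) ^ (K - n)) ∘ₗ onFun (GE (domT (hd := hd3) hN D hk) (cf_ne_zero ℓ n K) hws ∘ₗ
        QsE (domT (hd := hd3) hN D hk) ∘ₗ EE (domT (hd := hd3) hN D hk) (cf_ne_zero ℓ n K) hws) := by
    rw [LinearMap.comp_assoc, ← onFun_comp]
  rw [hcomp, LinearMap.comp_apply, onFun_H_eq_flatH ℓ hL m hm n K hN D hk hws he he', LapV_apply, hdist] at h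
  -- the P2 stencil is the port's stencil
  have hst : ∑ ν : Fin (2 + 1), ((flatH (⟨ℓ + 1, hL, m, hm⟩ : T3Family) n K (domT (hd := hd3) hN D hk) e b -
          flatH (⟨ℓ + 1, hL, m, hm⟩ : T3Family) n K (domT (hd := hd3) hN D hk) e ⟨b.src.shift ν, b.dir⟩) +
        (flatH (⟨ℓ + 1, hL, m, hm⟩ : T3Family) n K (domT (hd := hd3) hN D hk) e b -
          flatH (⟨ℓ + 1, hL, m, hm⟩ : T3Family) n K (domT (hd := hd3) hN D hk) e ⟨b.src.unshift ν, b.dir⟩)) =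
      ∑ ν : Fin (2 + 1), (2 * flatH (⟨ℓ + 1, hL, m, hm⟩ : T3Family) n K (domT (hd := hd3) hN D hk) e b -
        flatH (⟨ℓ + 1, hL, m, hm⟩ : T3Family) n K (domT (hd := hd3) hN D hk) e ⟨b.src.unshift ν, b.dir⟩ -
        flatH (⟨ℓ + 1, hL, m, hm⟩ : T3Family) n K (domT (hd := hd3) hN D hk) e ⟨b.src.shift ν, b.dir⟩) :=
    Finset.sum_congr rfl fun ν _ => by ring
  rw [hst]
  -- weights: `w₂(b) = (Lj/c′)² = pref(y(b))`
  have hw2 : w 2 b = (Lj / cf) ^ 2 := levWeight_eq ℓ hL m hm n K hN D hk hw 2 b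
  have hpref : pref cf (blkV1 hN D b) = (Lj / cf) ^ 2 := pref_blkV1 ℓ hL m n K hN D cf b
  rw [abs_mul, abs_of_pos (pow_pos hcf0 2)] at h
  have hexpA : Real.exp (-(r * dT)) = Real.exp (3 * r) * Real.exp (-(r * (dT + 3))) := by rw [← Real.exp_add]; congr 1; ring
  rw [hpref, hexpA] at h
  rw [hw2]
  have hq0 : 0 < (Lj / cf) ^ 2 := by positivity
  calc (Lj / cf) ^ 2 * cf ^ 2 * |∑ ν : Fin (2 + 1), (2 * flatH (⟨ℓ + 1, hL, m, hm⟩ : T3Family) n K (domT (hd := hd3) hN D hk) e b -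
          flatH (⟨ℓ + 1, hL, m, hm⟩ : T3Family) n K (domT (hd := hd3) hN D hk) e ⟨b.src.unshift ν, b.dir⟩ -
          flatH (⟨ℓ + 1, hL, m, hm⟩ : T3Family) n K (domT (hd := hd3) hN D hk) e ⟨b.src.shift ν, b.dir⟩)|
      = (Lj / cf) ^ 2 * (cf ^ 2 * |∑ ν : Fin (2 + 1), (2 * flatH (⟨ℓ + 1, hL, m, hm⟩ : T3Family) n K (domT (hd := hd3) hN D hk) e b -
          flatH (⟨ℓ + 1, hL, m, hm⟩ : T3Family) n K (domT (hd := hd3) hN D hk) e ⟨b.src.unshift ν, b.dir⟩ -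
          flatH (⟨ℓ + 1, hL, m, hm⟩ : T3Family) n K (domT (hd := hd3) hN D hk) e ⟨b.src.shift ν, b.dir⟩)|) := by ring
    _ ≤ (Lj / cf) ^ 2 * (A / (Lj / cf) ^ 2 * K₃ * (Real.exp (3 * r) * Real.exp (-(r * (dT + 3))))) := mul_le_mul_of_nonneg_left h hq0.le
    _ = ((Lj / cf) ^ 2 * (1 / (Lj / cf) ^ 2)) * (A * (K₃ * Real.exp (3 * r)) * Real.exp (-(r * (dT + 3)))) := by rw [div_eq_mul_one_div A]; ring
    _ = A * (K₃ * Real.exp (3 * r)) * Real.exp (-(r * (dT + 3))) := by rw [mul_one_div_cancel hq0.ne', one_mul]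

end Carrier

end Summit.QuantumFields.YangMills.Theorems.FlatPortHRows34

end
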